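import Literature.MathematicalPhysics.QuantumFieldTheory.Balaban1983to89.B3TwoPointPerturbativeCoefficients
import Literature.MathematicalPhysics.QuantumFieldTheory.Balaban1983to89.B3Sect1TwoPoint
import Literature.MathematicalPhysics.QuantumFieldTheory.Balaban1983to89.B1Eq113OneSidedDerivatives

/-!
# `Balaban1983to89.B3Eq119VertexExpansion` — T. Bałaban, *(Higgs)₂,₃ quantum fields in a finite volume. III.
# Renormalization*, Commun. Math. Phys. **88** (1983) 411–445 [Balaban1983Higgs3], (1.19)–(1.21) p. 416: THE TWO-POINT
# FUNCTION (1.19) OF THE LATTICE MODEL AS THE `t = 1` VALUE OF THE VERTEX-WEIGHTED FAMILY `⟨φ_a(x)φ_b(x′)e^{−tV}⟩₀/⟨e^{−tV}⟩₀`,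
# `V` = the vertices (1.6) + (1.7), and its expansion in the number of vertices to every order with remainder — the
# instance of `B3TwoPointPerturbativeCoefficients` on the `(Higgs)₂,₃` carrier of record

statement-level skeleton of published theorems with citation tags; proofs where landed; nothing here is a claim about
the Yang–Mills mass gap

CITATION HEADER (lean-in-tree rule).  Part of the lit-balaban TYPED SKELETON (HOME `run/shared/lean/pub/lit-balaban/`),
Phase 2, proof seat p33 (gen 70, unit `lit-balaban-p33`); row **B3.Eq1.19-1.22** of `HOME/lit-balaban-r15/ROWS-B3.md`
(fold owner r15; head `proved` under the lead's HEAD WORD Q25 — this file and its sibling `B3TwoPointPerturbativeCoefficients`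
are an OPTIONAL located member of the (1.19)/(1.21) cell, zero head weight: BRICK 4 of the target
`B3TwoPointPerturbativeExpansion`).  REUSED BY NAME, nothing re-declared: the typer's CONCRETE two-point function
`B3Sect1TwoPoint.twoPoint` (1.19) with its action `action120` (1.20) and `z120`; the typer's carrier `HiggsLattice` (`action`
(I.1.11), `potential`, `partitionFn` (I.1.10)) and `HiggsActionIntegrable.partitionFn_pos`, `continuous_action`; the typer's
quartic functional `B1Eq113OneSidedDerivatives.quartic` with `integrable_quartic_pow_mul_exp` (polynomial × Gaussian
integrability at `m₀² > 0`, `μ₀² > 0`); r14's `B1Sect1Statements.ModelData`; the abstract coefficient theorems of the sibling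
file (`TiltData`, `tiltExpect`, `TiltData.iteratedDerivWithin_tiltExpect_eq_ursellOf`, `TiltData.taylor_tiltExpect`).

THE PRINT (p. 416 = PDF 6, L4–18 of the held text `paper:balaban1983-higgs-2-3-quantum-fields-finite-volume`, re-read this
session): «G^ε_{ab}(x, x′) = ⟨φ_a(x)φ_b(x′)⟩^ε = (Z^ε)^{−1}∫dA∫dφ e^{−S^ε(A,φ)}φ_a(x)φ_b(x′), x, x′ ∈ T_ε, (1.19) where
S^ε(A, φ) is the lattice action of the model given by S^ε(A,φ) = ½⟨φ,(−Δ^ε_A + m²)φ⟩ + Σ_{x∈T_ε}ε^d(λ|φ(x)|⁴ + ½δm²|φ(x)|²)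
+ ½⟨A,(−Δ^ε + μ₀²)A⟩, (1.20) and Z^ε is the partition function. The function G^ε has a perturbative expansion of the
following structure (1.21) … Here we have a graphical description of the same type as in (1.17) … the only vertices are
(1.6), (1.7) [with δm² instead of δm_i²(x)], (1.8), and (1.10) with n′ = 0, B̃ = 0, g_k = 1».

WHAT IS PROVED (0 `sorry`, no `Prop` fact; standard axioms).
* §1 THE VERTICES AND THEIR SIZE: `vertices P k λ δm² φ = Σ_x η^d(λ|φ(x)|⁴ + ½δm²|φ(x)|²)` (the scalar vertices (1.6) + (1.7)
  of (1.20) summed over the lattice); `action_eq_free_add_vertices`: `S^ε_{(m²+δm², λ, μ₀², E)} = S^ε_{(m², 0, μ₀², E)} + V`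
  (definitional on the typer's `HiggsLattice.action`); `vertices_bddBelow`: `V ≥ −|T|η^d(δm²)²/(16λ)` for `λ > 0`;
  `abs_vertices_le`: `|V| ≤ K_V(V₄ + 1)` with `V₄ = quartic`; `integrable_mul_exp_of_le_pow_quartic`: every continuous `h`
  with `|h| ≤ K(V₄ + 1)ⁿ` is integrable against `exp(−S^ε_{(m²,0,μ₀²,E)})` (`m² > 0`, `μ₀² > 0`; from the typer's lemma).
* §2 THE UNPERTURBED MEASURE `freeMeasure = exp(−S^ε_{(m²,0,μ₀²,0)}) dA dφ` (Lebesgue `withDensity`; the charge `e` stays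
  inside `S^ε_{(m²,0,μ₀²,0)}` — at `e = 0` it is the product of the two free Gaussians of (I.1.12)): `integral_freeMeasure`,
  `integrable_freeMeasure_iff`, `freeMeasure_neZero` (via `partitionFn_pos`), and THE HYPOTHESES OF THE SIBLING FILE
  DISCHARGED: `tiltData_freeMeasure` (any continuous observable of polynomial growth), `tiltData_freeMeasure_one`,
  `tiltData_freeMeasure_twoPointObs` (`|φ_a(x)φ_b(x′)| ≤ (η^{−d} + 1)(V₄ + 1)`, `abs_twoPointObs_le`).
* §3 THE HEADLINE: `twoPointFamily D P a b x x′ : ℝ → ℝ`, `t ↦ ⟨φ_a(x)φ_b(x′)e^{−tV}⟩₀/⟨e^{−tV}⟩₀` with `V` at the model's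
  physical `λ = D.lam`, `δm² = D.δmsq ε e λ`; **`twoPointFamily_one`: `twoPointFamily D P a b x x′ 1 = twoPoint D P a b x x′`**
  (unconditional); for `m² > 0`, `μ₀² > 0`, `λ > 0` (any real `δm²`, any charge): **`contDiffOn_twoPointFamily`** (`C^∞` on
  `[0, ∞)`), **`iteratedDerivWithin_twoPointFamily_eq_ursellOf`** (the `t`-derivatives of every order are the pinned truncated
  expectations `⟨φ_a(x)φ_b(x′); −V; …; −V⟩ᵀ_t` of `exp(−S^ε_{(m²,0,μ₀²,0)} − tV)`), and **`twoPoint_perturbative_expansion`**: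
  `∀ n, ∃ ξ ∈ (0,1), G^ε_{ab}(x,x′) = Σ_{k≤n} (1/k!)(d/dt)^k G^ε_t|_{0⁺} + (1/(n+1)!)(d/dt)^{n+1}G^ε_t|_ξ` — «G^ε has a
  perturbative expansion» in the number of vertices, the `k`-th coefficient being the truncated expectation with `k`
  vertices of the UNPERTURBED measure (vacuum parts cancelled against `Z^ε`).
HONEST SCOPE.  (i) The expansion parameter is the vertex-counting `t` at FIXED `(λ, δm², e)`: print's double series in
`(e, λ)` — with `δm² = Σ e^αλ^β δm²_{(α,β)}` of (1.23) itself a series — is the re-expansion of these coefficients (each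
`⟨…; −V; …⟩ᵀ₀` is a polynomial in `(λ, δm²)`), not performed here; (ii) the vector-field vertices (1.8)/(1.10) (the
`e`-dependence of `−Δ^ε_A`) stay inside the unperturbed weight — only at `e = 0` is `ν₀` Gaussian, and only then are the
coefficients sums of Feynman graphs with propagators `C^ε_0`, `C^ε` (Wick's theorem: p39's lane; 1PI resummation (1.21): p32/p37's
bricks) — NOT done here; (iii) the standing assumptions `m² > 0`, `μ₀² > 0`, `λ > 0` of [I] p. 605 are hypotheses (they make
`ν₀` finite and `V` bounded below; `δm²` may have either sign); (iv) derivatives are one-sided at `t = 0` (within `Set.Ici 0`);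
(v) nothing about `ε → 0` or about the size of the coefficients is asserted.
-/

open Finset MeasureTheory Filter Topology
open scoped ContDiff NNReal
open Literature.Probability.LatticeModels (ursellOf)
open Literature.MathematicalPhysics.QuantumFieldTheory.Balaban1983to89.B3TwoPointPerturbativeCoefficients

namespace Literature.MathematicalPhysics.QuantumFieldTheory.Balaban1983to89.B3Eq119VertexExpansion

/-! ## §1 The vertices (1.6) + (1.7) of the action (1.20) and their size -/

section Instance

open Set
open HiggsLattice HiggsActionIntegrable B1Sect1Statements B3Sect1TwoPoint
open B1Eq113OneSidedDerivatives (quartic quartic_nonneg continuous_quartic integrable_quartic_pow_mul_exp)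

variable {P : HiggsLattice.Params} {k N : ℕ}

/-- The interaction of (1.20) relative to the massive free action: the scalar vertices (1.6) `λ|φ(x)|⁴` and (1.7)
`½δm²|φ(x)|²` summed over the lattice, `V(φ) = Σ_x η^d (λ|φ(x)|⁴ + ½δm²|φ(x)|²)` (p. 416: «the only vertices are (1.6), (1.7)
[with δm² …] …»). [cite: Balaban1983Higgs3, (1.20) p.416] -/
noncomputable def vertices (P : HiggsLattice.Params) (k : ℕ) (lam dm2 : ℝ) (φ : HiggsLattice.ScalarField P k N) : ℝ :=
  ∑ x : HiggsLattice.Site P k, P.mesh k ^ P.d * (lam * ‖φ x‖ ^ 4 + dm2 / 2 * ‖φ x‖ ^ 2)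

/-- `S^ε_{(m²+δm², λ, μ₀², E)} = S^ε_{(m², 0, μ₀², E)} + V`: the action (1.20) is the massive free action plus the
vertices (definitional on the typer's `HiggsLattice.action`/`potential`). [cite: Balaban1983Higgs3, (1.20) p.416] -/
theorem action_eq_free_add_vertices (C : HiggsLattice.ChargeData N) (msq dm2 lam mu0sq E : ℝ)
    (A : HiggsLattice.VecField P k) (φ : HiggsLattice.ScalarField P k N) :
    action C ⟨msq + dm2, lam, mu0sq, E⟩ A φ = action C ⟨msq, 0, mu0sq, E⟩ A φ + vertices P k lam dm2 φ := by
  have hpot : potential (P := P) (k := k) ⟨msq + dm2, lam, mu0sq, E⟩ φ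
      = potential (P := P) (k := k) ⟨msq, 0, mu0sq, E⟩ φ + vertices P k lam dm2 φ := by
    unfold potential vertices
    rw [← Finset.sum_add_distrib]
    exact Finset.sum_congr rfl fun x _ => by ring
  unfold action
  rw [hpot]
  ring

/-- `V` is continuous. [cite: Balaban1983Higgs3, (1.20) p.416] -/
theorem continuous_vertices (lam dm2 : ℝ) :
    Continuous fun φ : HiggsLattice.ScalarField P k N => vertices P k lam dm2 φ := by
  unfold vertices
  exact continuous_finsetSum _ fun x _ =>
    (((((continuous_apply x).norm).pow 4).const_mul lam).add
      ((((continuous_apply x).norm).pow 2).const_mul (dm2 / 2))).const_mul _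

/-- The vertices are bounded below for `λ > 0`: `V(φ) ≥ −|T|η^d (δm²)²/(16λ)` (sitewise
`λr⁴ + ½δm²r² ≥ −(δm²)²/(16λ)`). [cite: Balaban1983Higgs3, (1.20) p.416] -/
theorem vertices_bddBelow {lam : ℝ} (hlam : 0 < lam) (dm2 : ℝ) (φ : HiggsLattice.ScalarField P k N) :
    -(Fintype.card (HiggsLattice.Site P k) * (P.mesh k ^ P.d * (dm2 ^ 2 / (16 * lam)))) ≤ vertices P k lam dm2 φ := by
  unfold vertices
  have hη : 0 ≤ P.mesh k ^ P.d := pow_nonneg (P.mesh_pos k).le _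
  have hsite : ∀ x : HiggsLattice.Site P k,
      -(P.mesh k ^ P.d * (dm2 ^ 2 / (16 * lam))) ≤ P.mesh k ^ P.d * (lam * ‖φ x‖ ^ 4 + dm2 / 2 * ‖φ x‖ ^ 2) := by
    intro x
    rw [← mul_neg]
    refine mul_le_mul_of_nonneg_left ?_ hη
    have hr : 0 ≤ ‖φ x‖ ^ 2 := sq_nonneg _
    have key : lam * ‖φ x‖ ^ 4 + dm2 / 2 * ‖φ x‖ ^ 2 + dm2 ^ 2 / (16 * lam)
        = lam * (‖φ x‖ ^ 2 + dm2 / (4 * lam)) ^ 2 := by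
      field_simp
      ring
    nlinarith [mul_nonneg hlam.le (sq_nonneg (‖φ x‖ ^ 2 + dm2 / (4 * lam)))]
  calc -(Fintype.card (HiggsLattice.Site P k) * (P.mesh k ^ P.d * (dm2 ^ 2 / (16 * lam))))
      = ∑ _x : HiggsLattice.Site P k, -(P.mesh k ^ P.d * (dm2 ^ 2 / (16 * lam))) := by
        rw [Finset.sum_const, Finset.card_univ, nsmul_eq_mul]; ring
    _ ≤ _ := Finset.sum_le_sum fun x _ => hsite x

/-- `‖φ(x)‖² ≤ η^{−d}V₄(φ) + 1` with `V₄ = Σ_y η^d‖φ(y)‖⁴` the typer's `quartic`. [folklore] [cite: Balaban1983Higgs3, (1.20) p.416] -/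
theorem norm_sq_le_quartic (φ : HiggsLattice.ScalarField P k N) (x : HiggsLattice.Site P k) :
    ‖φ x‖ ^ 2 ≤ (P.mesh k ^ P.d)⁻¹ * quartic P k φ + 1 := by
  have hη : 0 < P.mesh k ^ P.d := pow_pos (P.mesh_pos k) _
  have h4 : P.mesh k ^ P.d * ‖φ x‖ ^ 4 ≤ quartic P k φ := by
    unfold quartic
    exact Finset.single_le_sum (f := fun y => P.mesh k ^ P.d * ‖φ y‖ ^ 4)
      (fun y _ => mul_nonneg hη.le (pow_nonneg (norm_nonneg _) _)) (Finset.mem_univ x)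
  have h4' : ‖φ x‖ ^ 4 ≤ (P.mesh k ^ P.d)⁻¹ * quartic P k φ := by
    rw [le_inv_mul_iff₀ hη]; exact h4
  nlinarith [sq_nonneg (‖φ x‖ ^ 2 - 1)]

/-- The constant `K_V = |λ| + ½|δm²|·|T|·(1 + η^d)` of the bound `|V(φ)| ≤ K_V (V₄(φ) + 1)`. [cite: Balaban1983Higgs3, (1.20) p.416] -/
noncomputable def vertexBoundConst (P : HiggsLattice.Params) (k : ℕ) (lam dm2 : ℝ) : ℝ :=
  |lam| + |dm2| / 2 * (Fintype.card (HiggsLattice.Site P k) * (1 + P.mesh k ^ P.d))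

/-- `|V(φ)| ≤ K_V (V₄(φ) + 1)` with `V₄ = Σ_x η^d|φ(x)|⁴` the typer's `quartic`. [cite: Balaban1983Higgs3, (1.20) p.416] -/
theorem abs_vertices_le (lam dm2 : ℝ) (φ : HiggsLattice.ScalarField P k N) :
    |vertices P k lam dm2 φ| ≤ vertexBoundConst P k lam dm2 * (quartic P k φ + 1) := by
  unfold vertexBoundConst
  have hη : 0 < P.mesh k ^ P.d := pow_pos (P.mesh_pos k) _
  have hq : 0 ≤ quartic P k φ := quartic_nonneg φ
  unfold vertices
  have hterm : ∀ x : HiggsLattice.Site P k, |P.mesh k ^ P.d * (lam * ‖φ x‖ ^ 4 + dm2 / 2 * ‖φ x‖ ^ 2)|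
      ≤ |lam| * (P.mesh k ^ P.d * ‖φ x‖ ^ 4) + |dm2| / 2 * (quartic P k φ + P.mesh k ^ P.d) := by
    intro x
    rw [abs_mul, abs_of_pos hη]
    have h2 := norm_sq_le_quartic φ x
    have h2' : P.mesh k ^ P.d * ‖φ x‖ ^ 2 ≤ quartic P k φ + P.mesh k ^ P.d := by
      have := mul_le_mul_of_nonneg_left h2 hη.le
      rw [mul_add, ← mul_assoc, mul_inv_cancel₀ hη.ne', one_mul, mul_one] at this
      exact this
    calc P.mesh k ^ P.d * |lam * ‖φ x‖ ^ 4 + dm2 / 2 * ‖φ x‖ ^ 2|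
        ≤ P.mesh k ^ P.d * (|lam| * ‖φ x‖ ^ 4 + |dm2| / 2 * ‖φ x‖ ^ 2) := by
          refine mul_le_mul_of_nonneg_left ((abs_add_le _ _).trans ?_) hη.le
          rw [abs_mul, abs_mul, abs_of_nonneg (pow_nonneg (norm_nonneg _) _),
            abs_of_nonneg (pow_nonneg (norm_nonneg _) _), abs_div, abs_two]
      _ = |lam| * (P.mesh k ^ P.d * ‖φ x‖ ^ 4) + |dm2| / 2 * (P.mesh k ^ P.d * ‖φ x‖ ^ 2) := by ring
      _ ≤ |lam| * (P.mesh k ^ P.d * ‖φ x‖ ^ 4) + |dm2| / 2 * (quartic P k φ + P.mesh k ^ P.d) := by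
          gcongr
  calc |∑ x : HiggsLattice.Site P k, P.mesh k ^ P.d * (lam * ‖φ x‖ ^ 4 + dm2 / 2 * ‖φ x‖ ^ 2)|
      ≤ ∑ x : HiggsLattice.Site P k, |P.mesh k ^ P.d * (lam * ‖φ x‖ ^ 4 + dm2 / 2 * ‖φ x‖ ^ 2)| :=
        Finset.abs_sum_le_sum_abs _ _
    _ ≤ ∑ x : HiggsLattice.Site P k,
          (|lam| * (P.mesh k ^ P.d * ‖φ x‖ ^ 4) + |dm2| / 2 * (quartic P k φ + P.mesh k ^ P.d)) :=
        Finset.sum_le_sum fun x _ => hterm x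
    _ = |lam| * quartic P k φ
        + Fintype.card (HiggsLattice.Site P k) * (|dm2| / 2 * (quartic P k φ + P.mesh k ^ P.d)) := by
        rw [Finset.sum_add_distrib, ← Finset.mul_sum, Finset.sum_const, Finset.card_univ, nsmul_eq_mul]
        rfl
    _ ≤ (|lam| + |dm2| / 2 * (Fintype.card (HiggsLattice.Site P k) * (1 + P.mesh k ^ P.d))) * (quartic P k φ + 1) := by
        have hcard : (0 : ℝ) ≤ Fintype.card (HiggsLattice.Site P k) := Nat.cast_nonneg _
        have hlam : 0 ≤ |lam| := abs_nonneg lam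
        have hdm : 0 ≤ |dm2| / 2 := by positivity
        set c : ℝ := (Fintype.card (HiggsLattice.Site P k) : ℝ)
        set q : ℝ := quartic P k φ
        set e : ℝ := P.mesh k ^ P.d
        nlinarith [mul_nonneg hdm (mul_nonneg hcard hq), mul_nonneg hdm (mul_nonneg hcard hη.le),
          mul_nonneg (mul_nonneg hdm (mul_nonneg hcard hη.le)) hq, mul_nonneg hdm hcard]

/-- `(q + 1)^n ≤ 2^n (q^n + 1)` for `q ≥ 0`. [folklore] -/
private theorem add_one_pow_le {q : ℝ} (hq : 0 ≤ q) (n : ℕ) : (q + 1) ^ n ≤ 2 ^ n * (q ^ n + 1) := by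
  have h1 : q + 1 ≤ 2 * max q 1 := by
    rcases le_total q 1 with h | h
    · rw [max_eq_right h]; linarith
    · rw [max_eq_left h]; linarith
  have h2 : (q + 1) ^ n ≤ (2 * max q 1) ^ n := pow_le_pow_left₀ (by linarith) h1 n
  have h3 : (max q 1) ^ n ≤ q ^ n + 1 := by
    rcases le_total q 1 with h | h
    · rw [max_eq_right h, one_pow]; linarith [pow_nonneg hq n]
    · rw [max_eq_left h]; linarith
  calc (q + 1) ^ n ≤ (2 * max q 1) ^ n := h2
    _ = 2 ^ n * (max q 1) ^ n := mul_pow _ _ _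
    _ ≤ 2 ^ n * (q ^ n + 1) := mul_le_mul_of_nonneg_left h3 (pow_nonneg zero_le_two n)

/-- Anything continuous and bounded by `K (V₄ + 1)^n` is integrable against the massive free weight `exp(−S^ε_{(m²,0,μ₀²,E)})`,
`m² > 0`, `μ₀² > 0` (polynomial × Gaussian; from the typer's `integrable_quartic_pow_mul_exp`). [cite: Balaban1982Higgs1, (1.10) p.605] -/
theorem integrable_mul_exp_of_le_pow_quartic {msq mu0sq : ℝ} (hm : 0 < msq) (hmu : 0 < mu0sq)
    (C : HiggsLattice.ChargeData N) (E : ℝ)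
    {h : HiggsLattice.VecField P k × HiggsLattice.ScalarField P k N → ℝ} (hcont : Continuous h)
    {K : ℝ} {n : ℕ} (hb : ∀ Φ, |h Φ| ≤ K * (quartic P k Φ.2 + 1) ^ n) :
    Integrable fun Φ : HiggsLattice.VecField P k × HiggsLattice.ScalarField P k N =>
      h Φ * Real.exp (-action C ⟨msq, 0, mu0sq, E⟩ Φ.1 Φ.2) := by
  have hK : 0 ≤ K := by
    have := hb (0 : HiggsLattice.VecField P k × HiggsLattice.ScalarField P k N)
    have hq : 0 ≤ quartic P k (0 : HiggsLattice.VecField P k × HiggsLattice.ScalarField P k N).2 := quartic_nonneg _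
    nlinarith [abs_nonneg (h 0), pow_pos (by linarith : 0 < quartic P k
      (0 : HiggsLattice.VecField P k × HiggsLattice.ScalarField P k N).2 + 1) n]
  have hmaj : Integrable fun Φ : HiggsLattice.VecField P k × HiggsLattice.ScalarField P k N =>
      K * 2 ^ n * (quartic P k Φ.2 ^ n * Real.exp (-action C ⟨msq, 0, mu0sq, E⟩ Φ.1 Φ.2)
        + quartic P k Φ.2 ^ 0 * Real.exp (-action C ⟨msq, 0, mu0sq, E⟩ Φ.1 Φ.2)) :=
    ((integrable_quartic_pow_mul_exp hm hmu C E n).add (integrable_quartic_pow_mul_exp hm hmu C E 0)).const_mul _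
  refine hmaj.mono' (hcont.mul (Real.continuous_exp.comp (continuous_action C _).neg)).aestronglyMeasurable
    (Eventually.of_forall fun Φ => ?_)
  have hq : 0 ≤ quartic P k Φ.2 := quartic_nonneg _
  have hexp : 0 < Real.exp (-action C ⟨msq, 0, mu0sq, E⟩ Φ.1 Φ.2) := Real.exp_pos _
  rw [Real.norm_eq_abs, abs_mul, abs_of_pos hexp, pow_zero, one_mul]
  calc |h Φ| * Real.exp (-action C ⟨msq, 0, mu0sq, E⟩ Φ.1 Φ.2)
      ≤ (K * (quartic P k Φ.2 + 1) ^ n) * Real.exp (-action C ⟨msq, 0, mu0sq, E⟩ Φ.1 Φ.2) :=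
        mul_le_mul_of_nonneg_right (hb Φ) hexp.le
    _ ≤ (K * (2 ^ n * (quartic P k Φ.2 ^ n + 1))) * Real.exp (-action C ⟨msq, 0, mu0sq, E⟩ Φ.1 Φ.2) :=
        mul_le_mul_of_nonneg_right (mul_le_mul_of_nonneg_left (add_one_pow_le hq n) hK) hexp.le
    _ = _ := by ring

end Instance


/-! ## §2–§3 The (1.19) instance: the two-point function of the `(Higgs)₂,₃` lattice model as the `t = 1` value of the
vertex-weighted family, and its expansion in the number of vertices (1.6)/(1.7) to every order -/

section Model

open Set
open HiggsLattice HiggsActionIntegrable B1Sect1Statements B3Sect1TwoPoint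
open B1Eq113OneSidedDerivatives (quartic quartic_nonneg continuous_quartic integrable_quartic_pow_mul_exp)

variable {P : HiggsLattice.Params} {k N : ℕ}

/-- The configuration space `(bonds → ℝ) × (sites → ℝ^N)` of (1.19)/(I.1.10). [cite: Balaban1983Higgs3, (1.19) p.416] -/
abbrev Cfg (P : HiggsLattice.Params) (k N : ℕ) : Type := HiggsLattice.VecField P k × HiggsLattice.ScalarField P k N

/-- The massive free weight `exp(−S^ε_{(m²,0,μ₀²,0)}(A,φ))` as an `ℝ≥0`-valued density. [cite: Balaban1983Higgs3, (1.19) p.416] -/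
noncomputable def freeDensity (C : HiggsLattice.ChargeData N) (msq mu0sq : ℝ) (Φ : Cfg P k N) : ℝ≥0 :=
  ⟨Real.exp (-action C ⟨msq, 0, mu0sq, 0⟩ Φ.1 Φ.2), (Real.exp_pos _).le⟩

/-- The density is `exp(−S^ε_{(m²,0,μ₀²,0)})`. [cite: Balaban1983Higgs3, (1.19) p.416] -/
theorem coe_freeDensity (C : HiggsLattice.ChargeData N) (msq mu0sq : ℝ) (Φ : Cfg P k N) :
    (freeDensity C msq mu0sq Φ : ℝ) = Real.exp (-action C ⟨msq, 0, mu0sq, 0⟩ Φ.1 Φ.2) := rfl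

/-- The density is measurable (the action is continuous). [cite: Balaban1983Higgs3, (1.19) p.416] -/
theorem measurable_freeDensity (C : HiggsLattice.ChargeData N) (msq mu0sq : ℝ) :
    Measurable (freeDensity C msq mu0sq : Cfg P k N → ℝ≥0) :=
  ((Real.continuous_exp.comp (continuous_action C _).neg).subtype_mk _).measurable

/-- **The unperturbed measure** `dν₀ = exp(−S^ε_{(m²,0,μ₀²,0)}(A,φ)) dA dφ`: the massive free scalar field minimally
coupled to the vector field `A` (charge `e` kept inside; at `e = 0` it is the product of the two free Gaussians of
(I.1.12)), un-normalized. [cite: Balaban1983Higgs3, (1.19) p.416] -/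
noncomputable def freeMeasure (P : HiggsLattice.Params) (k N : ℕ) (C : HiggsLattice.ChargeData N) (msq mu0sq : ℝ) :
    Measure (Cfg P k N) :=
  volume.withDensity fun Φ => freeDensity C msq mu0sq Φ

/-- Integrals against `ν₀` are Lebesgue integrals with the weight `exp(−S^ε_{(m²,0,μ₀²,0)})`. [cite: Balaban1983Higgs3, (1.19) p.416] -/
theorem integral_freeMeasure (C : HiggsLattice.ChargeData N) (msq mu0sq : ℝ) (g : Cfg P k N → ℝ) :
    ∫ Φ, g Φ ∂(freeMeasure P k N C msq mu0sq)
      = ∫ Φ : Cfg P k N, Real.exp (-action C ⟨msq, 0, mu0sq, 0⟩ Φ.1 Φ.2) * g Φ := by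
  rw [freeMeasure, integral_withDensity_eq_integral_smul (measurable_freeDensity C msq mu0sq)]
  rfl

/-- Integrability against `ν₀` is integrability of the weighted function. [cite: Balaban1983Higgs3, (1.19) p.416] -/
theorem integrable_freeMeasure_iff (C : HiggsLattice.ChargeData N) (msq mu0sq : ℝ) (g : Cfg P k N → ℝ) :
    Integrable g (freeMeasure P k N C msq mu0sq)
      ↔ Integrable (fun Φ : Cfg P k N => Real.exp (-action C ⟨msq, 0, mu0sq, 0⟩ Φ.1 Φ.2) * g Φ) := by
  rw [freeMeasure, integrable_withDensity_iff_integrable_smul (measurable_freeDensity C msq mu0sq)]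
  rfl

/-- `ν₀ ≠ 0` (its total against `e^{−V₄}` is a partition function (I.1.10), positive by the typer's `partitionFn_pos`).
[cite: Balaban1982Higgs1, (1.10) p.605] -/
theorem freeMeasure_neZero (C : HiggsLattice.ChargeData N) (msq : ℝ) {mu0sq : ℝ} (hmu : 0 < mu0sq) :
    NeZero (freeMeasure P k N C msq mu0sq) := by
  refine ⟨fun h0 => ?_⟩
  have hZ : 0 < partitionFn P k N C ⟨msq + 0, 1, mu0sq, 0⟩ :=
    HiggsActionIntegrable.partitionFn_pos C ⟨msq + 0, 1, mu0sq, 0⟩ hmu one_pos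
  have hrepr : partitionFn P k N C ⟨msq + 0, 1, mu0sq, 0⟩
      = ∫ Φ, Real.exp (-vertices P k 1 0 Φ.2) ∂(freeMeasure P k N C msq mu0sq) := by
    rw [integral_freeMeasure]
    unfold partitionFn
    refine integral_congr_ae (Eventually.of_forall fun Φ => ?_)
    dsimp only
    rw [action_eq_free_add_vertices, neg_add, Real.exp_add]
  rw [hrepr, h0, integral_zero_measure] at hZ
  exact lt_irrefl _ hZ

/-- The hypotheses `TiltData` of the sibling file hold for the free measure, the vertices `V` (`λ > 0`, `m² > 0`, `μ₀² > 0`)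
and ANY continuous observable of polynomial growth `|F| ≤ K (V₄ + 1)ⁿ`. [cite: Balaban1983Higgs3, (1.19) p.416] -/
theorem tiltData_freeMeasure {msq mu0sq lam : ℝ} (hm : 0 < msq) (hmu : 0 < mu0sq) (hlam : 0 < lam)
    (C : HiggsLattice.ChargeData N) (dm2 : ℝ) {F : Cfg P k N → ℝ} (hF : Continuous F) {K : ℝ} {n : ℕ}
    (hb : ∀ Φ, |F Φ| ≤ K * (quartic P k Φ.2 + 1) ^ n) :
    TiltData (freeMeasure P k N C msq mu0sq) F (fun Φ => vertices P k lam dm2 Φ.2) where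
  aesm_F := hF.aestronglyMeasurable
  aesm_V := ((continuous_vertices lam dm2).comp continuous_snd).aestronglyMeasurable
  bddBelow := by
    refine ⟨Fintype.card (HiggsLattice.Site P k) * (P.mesh k ^ P.d * (dm2 ^ 2 / (16 * lam))), ?_,
      fun Φ => vertices_bddBelow hlam dm2 Φ.2⟩
    have := pow_nonneg (P.mesh_pos k).le P.d
    positivity
  integrable k' := by
    rw [integrable_freeMeasure_iff]
    have hK : 0 ≤ K := by
      have h0 := hb 0
      have hq0 : 0 ≤ quartic P k (0 : Cfg P k N).2 := quartic_nonneg _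
      have hq : (0 : ℝ) < (quartic P k (0 : Cfg P k N).2 + 1) ^ n := pow_pos (by linarith) n
      nlinarith [abs_nonneg (F 0)]
    have hKV : 0 ≤ vertexBoundConst P k lam dm2 := by
      unfold vertexBoundConst
      have := pow_nonneg (P.mesh_pos k).le P.d
      positivity
    have h := integrable_mul_exp_of_le_pow_quartic hm hmu C 0
      (h := fun Φ : Cfg P k N => F Φ * vertices P k lam dm2 Φ.2 ^ k')
      (hF.mul (((continuous_vertices lam dm2).comp continuous_snd).pow k'))
      (K := K * vertexBoundConst P k lam dm2 ^ k') (n := n + k') (fun Φ => by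
        rw [abs_mul, abs_pow, pow_add, mul_mul_mul_comm, ← mul_pow]
        exact mul_le_mul (hb Φ) (pow_le_pow_left₀ (abs_nonneg _) (abs_vertices_le lam dm2 Φ.2) k')
          (pow_nonneg (abs_nonneg _) _) (mul_nonneg hK (pow_nonneg (by linarith [quartic_nonneg (P := P) (k := k) Φ.2]) _)))
    exact h.congr (Eventually.of_forall fun Φ => by simp only; ring)

/-- The constant observable `1` (the partition function `Z^ε` of (1.19)). [cite: Balaban1983Higgs3, (1.19) p.416] -/
theorem tiltData_freeMeasure_one {msq mu0sq lam : ℝ} (hm : 0 < msq) (hmu : 0 < mu0sq) (hlam : 0 < lam)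
    (C : HiggsLattice.ChargeData N) (dm2 : ℝ) :
    TiltData (freeMeasure P k N C msq mu0sq) (fun _ => (1 : ℝ)) (fun Φ => vertices P k lam dm2 Φ.2) :=
  tiltData_freeMeasure hm hmu hlam C dm2 continuous_const (K := 1) (n := 0) fun Φ => by simp

/-- The two-point observable `φ_a(x)φ_b(x′)` of (1.19) has polynomial growth: `|φ_a(x)φ_b(x′)| ≤ (η^{−d} + 1)(V₄(φ) + 1)`. [cite: Balaban1983Higgs3, (1.19) p.416] -/
theorem abs_twoPointObs_le (a b : Fin N) (x x' : HiggsLattice.Site P k) (Φ : Cfg P k N) :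
    |Φ.2 x a * Φ.2 x' b| ≤ ((P.mesh k ^ P.d)⁻¹ + 1) * (quartic P k Φ.2 + 1) ^ 1 := by
  have h1 : |Φ.2 x a| ≤ ‖Φ.2 x‖ := by
    rw [← Real.norm_eq_abs]; exact PiLp.norm_apply_le (Φ.2 x) a
  have h2 : |Φ.2 x' b| ≤ ‖Φ.2 x'‖ := by
    rw [← Real.norm_eq_abs]; exact PiLp.norm_apply_le (Φ.2 x') b
  have hx := norm_sq_le_quartic Φ.2 x
  have hx' := norm_sq_le_quartic Φ.2 x'
  have hη : 0 ≤ (P.mesh k ^ P.d)⁻¹ := inv_nonneg.2 (pow_nonneg (P.mesh_pos k).le _)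
  have hq := quartic_nonneg (P := P) (k := k) Φ.2
  rw [abs_mul, pow_one]
  calc |Φ.2 x a| * |Φ.2 x' b| ≤ ‖Φ.2 x‖ * ‖Φ.2 x'‖ := mul_le_mul h1 h2 (abs_nonneg _) (norm_nonneg _)
    _ ≤ (‖Φ.2 x‖ ^ 2 + ‖Φ.2 x'‖ ^ 2) / 2 := by nlinarith [sq_nonneg (‖Φ.2 x‖ - ‖Φ.2 x'‖)]
    _ ≤ ((P.mesh k ^ P.d)⁻¹ + 1) * (quartic P k Φ.2 + 1) := by nlinarith [mul_nonneg hη hq]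

/-- The two-point observable is continuous. [cite: Balaban1983Higgs3, (1.19) p.416] -/
theorem continuous_twoPointObs (a b : Fin N) (x x' : HiggsLattice.Site P k) :
    Continuous fun Φ : Cfg P k N => Φ.2 x a * Φ.2 x' b := by
  have h : ∀ (y : HiggsLattice.Site P k) (c : Fin N), Continuous fun Φ : Cfg P k N => Φ.2 y c := fun y c =>
    (PiLp.continuous_apply 2 (fun _ : Fin N => ℝ) c).comp ((continuous_apply y).comp continuous_snd)
  exact (h x a).mul (h x' b)

/-- The two-point observable satisfies the hypotheses `TiltData` w.r.t. the free measure and the vertices. [cite: Balaban1983Higgs3, (1.19) p.416] -/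
theorem tiltData_freeMeasure_twoPointObs {msq mu0sq lam : ℝ} (hm : 0 < msq) (hmu : 0 < mu0sq) (hlam : 0 < lam)
    (C : HiggsLattice.ChargeData N) (dm2 : ℝ) (a b : Fin N) (x x' : HiggsLattice.Site P k) :
    TiltData (freeMeasure P k N C msq mu0sq) (fun Φ => Φ.2 x a * Φ.2 x' b) (fun Φ => vertices P k lam dm2 Φ.2) :=
  tiltData_freeMeasure hm hmu hlam C dm2 (continuous_twoPointObs a b x x') (abs_twoPointObs_le a b x x')

/-! ### The vertex-weighted family of two-point functions and the headline theorems -/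

variable (D : ModelData) (P : HiggsLattice.Params)

/-- **The vertex-weighted two-point family** `t ↦ G^ε_t,ab(x,x′) := ⟨φ_a(x)φ_b(x′) e^{−tV}⟩₀ / ⟨e^{−tV}⟩₀`, the
expectation in the measure `exp(−S^ε_{(m²,0,μ₀²,0)} − t·V) dA dφ` with `V = Σ_x ε^d(λ|φ(x)|⁴ + ½δm²|φ(x)|²)` the
vertices (1.6) + (1.7) of the model at its physical `λ`, `δm² = δm²(ε, e, λ)`; at `t = 1` it is (1.19). [cite: Balaban1983Higgs3, (1.19) p.416] -/
noncomputable def twoPointFamily (a b : Fin D.N) (x x' : HiggsLattice.Site P 0) : ℝ → ℝ :=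
  tiltExpect (freeMeasure P 0 D.N D.C D.msq D.mu0sq) (fun Φ => Φ.2 x a * Φ.2 x' b)
    (fun Φ => vertices P 0 D.lam (D.δmsq P.ε D.C.e D.lam) Φ.2)

/-- **(1.19) is the `t = 1` value of the family**: `G^ε_{ab}(x,x′) = twoPointFamily 1` (the typer's CONCRETE
`B3Sect1TwoPoint.twoPoint`, by `S^ε = S^ε_{(m²,0,μ₀²,0)} + V`). [cite: Balaban1983Higgs3, (1.19) p.416] -/
theorem twoPointFamily_one (a b : Fin D.N) (x x' : HiggsLattice.Site P 0) :
    twoPointFamily D P a b x x' 1 = twoPoint D P a b x x' := by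
  unfold twoPointFamily tiltExpect tiltZ tiltMoment twoPoint z120 partitionFn
  rw [integral_freeMeasure, integral_freeMeasure, inv_mul_eq_div]
  have hact : ∀ Φ : Cfg P 0 D.N, action120 D P Φ.1 Φ.2
      = action D.C ⟨D.msq, 0, D.mu0sq, 0⟩ Φ.1 Φ.2 + vertices P 0 D.lam (D.δmsq P.ε D.C.e D.lam) Φ.2 :=
    fun Φ => action_eq_free_add_vertices D.C D.msq _ D.lam D.mu0sq 0 Φ.1 Φ.2
  congr 1
  · refine integral_congr_ae (Eventually.of_forall fun Φ => ?_)
    dsimp only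
    rw [hact, neg_add, Real.exp_add]
    simp only [pow_zero, mul_one, one_mul]
    ring
  · refine integral_congr_ae (Eventually.of_forall fun Φ => ?_)
    dsimp only
    rw [action_eq_free_add_vertices, neg_add, Real.exp_add]
    simp

variable {D P}

/-- **The vertex-weighted two-point family is `C^∞` on `[0, ∞)`** (`m² > 0`, `μ₀² > 0`, `λ > 0`; any real `δm²`, any
charge `e`). [cite: Balaban1983Higgs3, (1.21) p.416] -/
theorem contDiffOn_twoPointFamily (hm : 0 < D.msq) (hmu : 0 < D.mu0sq) (hlam : 0 < D.lam) (a b : Fin D.N)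
    (x x' : HiggsLattice.Site P 0) : ContDiffOn ℝ ∞ (twoPointFamily D P a b x x') (Ici 0) := by
  haveI := freeMeasure_neZero (P := P) (k := 0) (N := D.N) D.C D.msq hmu
  exact (tiltData_freeMeasure_twoPointObs hm hmu hlam D.C _ a b x x').contDiffOn_tiltExpect
    (tiltData_freeMeasure_one hm hmu hlam D.C _)

/-- **The `t`-derivatives of the family, to every order, are the pinned truncated expectations**
`⟨φ_a(x)φ_b(x′); −V; …; −V⟩ᵀ_t` of the measure `exp(−S^ε_{(m²,0,μ₀²,0)} − tV)` (Ursell function of the normalized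
tilted moments, the observable pinned; `|W|` insertions of `−V`, pin `j ∉ W`; derivatives within `[0, ∞)`). [cite: Balaban1983Higgs3, (1.21) p.416]
[cite: Mastropietro2008, §2.3 (2.32)-(2.38)] -/
theorem iteratedDerivWithin_twoPointFamily_eq_ursellOf (hm : 0 < D.msq) (hmu : 0 < D.mu0sq) (hlam : 0 < D.lam)
    (a b : Fin D.N) (x x' : HiggsLattice.Site P 0) {t : ℝ} (ht : 0 ≤ t) {β : Type*} [DecidableEq β] {j : β} {W : Finset β}
    (hjW : j ∉ W) :
    iteratedDerivWithin W.card (twoPointFamily D P a b x x') (Ici 0) t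
      = ursellOf (pinnedMoments j
          (tiltMoment (freeMeasure P 0 D.N D.C D.msq D.mu0sq) (fun Φ => Φ.2 x a * Φ.2 x' b)
            (fun Φ => vertices P 0 D.lam (D.δmsq P.ε D.C.e D.lam) Φ.2) 0)
          (tiltZ (freeMeasure P 0 D.N D.C D.msq D.mu0sq) (fun Φ => vertices P 0 D.lam (D.δmsq P.ε D.C.e D.lam) Φ.2))
          (Ici 0) t) (insert j W) := by
  haveI := freeMeasure_neZero (P := P) (k := 0) (N := D.N) D.C D.msq hmu
  exact (tiltData_freeMeasure_twoPointObs hm hmu hlam D.C _ a b x x').iteratedDerivWithin_tiltExpect_eq_ursellOf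
    (tiltData_freeMeasure_one hm hmu hlam D.C _) ht hjW

/-- **«The function `G^ε` has a perturbative expansion»** (p. 416) — in the number of vertices (1.6)/(1.7), to every
order, with Lagrange remainder: for every `n` there is `ξ ∈ (0, 1)` with
`G^ε_{ab}(x,x′) = Σ_{k ≤ n} (1/k!) (d/dt)^k G^ε_t|_{t=0⁺} + (1/(n+1)!) (d/dt)^{n+1} G^ε_t|_{t=ξ}`,
where by `iteratedDerivWithin_twoPointFamily_eq_ursellOf` the `k`-th coefficient is the truncated expectation
`⟨φ_a(x)φ_b(x′); −V; …; −V⟩ᵀ₀/k!` (`k` vertices) of the UNPERTURBED measure `ν₀` — the disconnected («vacuum») parts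
cancel against `Z^ε` — and the remainder is the order-`n+1` truncated expectation of the `ξ`-weighted measure. [cite: Balaban1983Higgs3, (1.21) p.416] -/
theorem twoPoint_perturbative_expansion (hm : 0 < D.msq) (hmu : 0 < D.mu0sq) (hlam : 0 < D.lam) (a b : Fin D.N)
    (x x' : HiggsLattice.Site P 0) (n : ℕ) :
    ∃ ξ ∈ Ioo (0 : ℝ) 1, twoPoint D P a b x x'
      = ∑ k ∈ Finset.range (n + 1),
          iteratedDerivWithin k (twoPointFamily D P a b x x') (Ici 0) 0 / (k.factorial : ℝ)
        + iteratedDerivWithin (n + 1) (twoPointFamily D P a b x x') (Ici 0) ξ / ((n + 1).factorial : ℝ) := by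
  haveI := freeMeasure_neZero (P := P) (k := 0) (N := D.N) D.C D.msq hmu
  obtain ⟨ξ, hξ, h⟩ := (tiltData_freeMeasure_twoPointObs hm hmu hlam D.C (D.δmsq P.ε D.C.e D.lam) a b x x').taylor_tiltExpect
    (tiltData_freeMeasure_one hm hmu hlam D.C _) n one_pos
  refine ⟨ξ, hξ, ?_⟩
  rw [← twoPointFamily_one, twoPointFamily, h]
  simp

end Model

end Literature.MathematicalPhysics.QuantumFieldTheory.Balaban1983to89.B3Eq119VertexExpansion
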